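import Mathlib
import Literature.Analysis.FluidPDE.SpaceTimeCalculus
import Literature.Analysis.FluidPDE.ClassicalSolutionCalculus
import Literature.Analysis.FluidPDE.EnstrophySplitting
import HarnessLib

/-!
# Anchor of crux `LinearLiouvilleSeven` (route `SymmetryModuliCount`), gradient-is-caloric step

Registered stub `stub_anchorGradientCaloric` (C1) of the lead's skeleton for crux
stmt-NavierStokesRegularity-4054, line `galilean-collapse`. The anchor is the `u = 0` case of the
crux: tempered classical ancient solutions `(v, q)` of the Stokes system `∂ₜv = Δv − ∇q`,
`div v = 0` on `(−∞, 0) × ℝ³` are spatially constant on every slice. The pressure step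
(`stub_anchorPressure`) shows that `∇q(t, ·)` is slice-constant; this file proves the next step:
if `∇q(t, x) = ∇q(t, 0)` then every entry `w(t, x) = ⟪Dv(t, x) a, b⟫` of the velocity gradient is

* jointly `C^∞` on `(−∞, 0) × ℝ³`, and
* an ancient **caloric** function: `∂ₜw = Δw`.

Proof: `∂ₜ⟪Dv a, b⟫ = ⟪D(∂ₜv) a, b⟫` (exchange of `∂ₜ` and `D` on the open time set `Iio 0`,
`IsSmoothSpaceTimeOn.hasDerivAt_fderiv_slice`) `= ⟪D(Δv − ∇q(t, 0)) a, b⟫ = ⟪D(Δv) a, b⟫`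
(`fderiv_sub_const`) `= ⟪Δ(∂ₐv), b⟫` (`DΔ = ΔD` for `C³` fields,
`fderiv_laplacian_apply_of_contDiff_three`) `= Δ⟪∂ₐv, b⟫` (`Δ` commutes with the continuous
linear functional `⟪b, ·⟫`, Mathlib `ContDiffAt.laplacian_CLM_comp_left`).
-/

noncomputable section

open Set Function Filter InnerProductSpace
open scoped Laplacian ContDiff Topology RealInnerProductSpace

namespace Summit.NavierStokesRegularity.NavierStokesRegularity.Theorems

open Literature.Analysis.FluidPDE

/-- The entry `(t, x) ↦ ⟪D(v t)(x) a, b⟫` of the slice gradient of a field jointly smooth on the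
open time set `(−∞, 0)` is jointly smooth there. -/
theorem anchorGradCaloric_isSmoothSpaceTimeOn_entry
    {v : ℝ → EuclideanSpace ℝ (Fin 3) → EuclideanSpace ℝ (Fin 3)}
    (hv : IsSmoothSpaceTimeOn (Iio 0) v) (a b : EuclideanSpace ℝ (Fin 3)) :
    IsSmoothSpaceTimeOn (Iio 0) fun t x => ⟪fderiv ℝ (v t) x a, b⟫ :=
  (hv.isSmoothSpaceTimeOn_fderiv_apply isOpen_Iio a).inner (v' := fun _ _ => b) contDiffOn_const

/-- Exchange of `∂ₜ` and `∂ₐ` inside the inner product: for `t < 0`,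
`∂ₜ ⟪D(v ·)(x) a, b⟫ (t) = ⟪D(∂ₜv(t, ·))(x) a, b⟫`. -/
theorem anchorGradCaloric_deriv_entry
    {v : ℝ → EuclideanSpace ℝ (Fin 3) → EuclideanSpace ℝ (Fin 3)}
    (hv : IsSmoothSpaceTimeOn (Iio 0) v) {t : ℝ} (ht : t < 0)
    (x a b : EuclideanSpace ℝ (Fin 3)) :
    deriv (fun s => ⟪fderiv ℝ (v s) x a, b⟫) t =
      ⟪fderiv ℝ (fun y => deriv (fun s => v s y) t) x a, b⟫ := by
  have h := (hv.hasDerivAt_fderiv_slice isOpen_Iio ht x a).inner ℝ (hasDerivAt_const t b)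
  rw [h.deriv, inner_zero_right, zero_add]

/-- The slice Laplacian commutes with the inner product against a fixed vector: for a `C²`
field `g`, `Δ (⟪g ·, b⟫) x = ⟪Δ g x, b⟫`. -/
theorem anchorGradCaloric_laplacian_inner_const
    {g : EuclideanSpace ℝ (Fin 3) → EuclideanSpace ℝ (Fin 3)} (hg : ContDiff ℝ 2 g)
    (b x : EuclideanSpace ℝ (Fin 3)) :
    (Δ fun y => ⟪g y, b⟫) x = ⟪(Δ g) x, b⟫ := by
  have he : (fun y => ⟪g y, b⟫) = (innerSL ℝ b) ∘ g := by
    funext y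
    rw [Function.comp_apply, innerSL_apply_apply, real_inner_comm]
  rw [he, hg.contDiffAt.laplacian_CLM_comp_left, Function.comp_apply, innerSL_apply_apply,
    real_inner_comm]

/-- **Registered stub C1 (`stub_anchorGradientCaloric`) of crux stmt-NavierStokesRegularity-4054,
line `galilean-collapse`: the velocity gradient of an ancient Stokes pair with slice-constant
pressure gradient is caloric.** For `(v, q)` jointly smooth on `(−∞, 0) × ℝ³` with
`∂ₜv = Δv − ∇q` and `∇q(t, x) = ∇q(t, 0)`, every entry `w(t, x) = ⟪Dv(t, x) a, b⟫` is jointly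
`C^∞` on `(−∞, 0) × ℝ³` and solves the heat equation `∂ₜw = Δw` there. -/
theorem stub_anchorGradientCaloric :
    ∀ (v : ℝ → EuclideanSpace ℝ (Fin 3) → EuclideanSpace ℝ (Fin 3))
      (q : ℝ → EuclideanSpace ℝ (Fin 3) → ℝ),
      ContDiffOn ℝ (⊤ : ℕ∞) (Function.uncurry v) (Set.Iio 0 ×ˢ Set.univ) →
      ContDiffOn ℝ (⊤ : ℕ∞) (Function.uncurry q) (Set.Iio 0 ×ˢ Set.univ) →
      (∀ t < 0, ∀ x, Literature.Analysis.FluidPDE.timeDeriv v t x =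
        Laplacian.laplacian (v t) x - gradient (q t) x) →
      (∀ t < 0, ∀ x, gradient (q t) x = gradient (q t) 0) →
      ∀ a b : EuclideanSpace ℝ (Fin 3),
        ContDiffOn ℝ (⊤ : ℕ∞)
          (Function.uncurry fun t x => inner ℝ (fderiv ℝ (v t) x a) b) (Set.Iio 0 ×ˢ Set.univ) ∧
        ∀ t < 0, ∀ x,
          Literature.Analysis.FluidPDE.timeDeriv (fun t x => inner ℝ (fderiv ℝ (v t) x a) b) t x =
            Laplacian.laplacian (fun x => inner ℝ (fderiv ℝ (v t) x a) b) x := by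
  intro v q hv _hq heq hgrad a b
  have hvS : IsSmoothSpaceTimeOn (Iio 0) v := hv
  refine ⟨anchorGradCaloric_isSmoothSpaceTimeOn_entry hvS a b, fun t ht x => ?_⟩
  have hvt3 : ContDiff ℝ 3 (v t) := (hvS.contDiff_slice ht).of_le (by norm_cast)
  -- the slice equation as functions: `∂ₜv(t, ·) = Δv(t, ·) − ∇q(t, 0)`
  have hslice : (fun y => deriv (fun s => v s y) t) = fun y => (Δ (v t)) y - gradient (q t) 0 := by
    funext y
    rw [← timeDeriv_apply, heq t ht y, hgrad t ht y]
  -- `∂ₐ v(t, ·)` is `C²`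
  have hg2 : ContDiff ℝ 2 (fun y => fderiv ℝ (v t) y a) :=
    ((hvS.contDiff_slice ht).fderiv_right (m := 2) (by norm_cast)).clm_apply contDiff_const
  rw [timeDeriv_apply, anchorGradCaloric_deriv_entry hvS ht x a b, hslice, fderiv_sub_const,
    fderiv_laplacian_apply_of_contDiff_three hvt3 x a,
    anchorGradCaloric_laplacian_inner_const hg2 b x]

end Summit.NavierStokesRegularity.NavierStokesRegularity.Theorems

end
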